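import Mathlib.Algebra.Star.Basic
import Mathlib.Tactic.NoncommRing
import Mathlib.Algebra.Module.LinearMap.End
import Mathlib.Algebra.Group.Units.Basic
import Mathlib.Analysis.SpecificLimits.Normed
import Mathlib.Analysis.Normed.Module.Basic
import HarnessLib

/-!
# The Feshbach–Schur map: isospectrality and the kernel correspondence (Gustafson–Sigal, Thm. 11.1), algebraic core

Source: S. J. Gustafson, I. M. Sigal, *Mathematical Concepts of Quantum Mechanics* (Universitext, Springer 2003), §11.1
«The Feshbach–Schur Method», **Theorem 11.1**, with the proof of §11.4 «Appendix: Proof of Theorem 11.1» (Proposition 11.3,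
identities (11.28)–(11.36)) [held: `book:gustafson2003-mathematical-concepts-quantum-mechanics` p0129 (statement), p0138–p0140 (proof)].
Printed setting: `P`, `P̄ = 1 − P` orthogonal projections on a Hilbert space, `H` self-adjoint with `Ran P ⊆ D(H)`,
`H_{P̄} := P̄HP̄ ↾ Ran P̄` invertible with `R_{P̄} := P̄ H_{P̄}⁻¹ P̄`, `PHR_{P̄}`, `R_{P̄}HP` bounded (11.6); the FESHBACH–SCHUR MAP
`F_P(H) := P(H − H R_{P̄} H)P ↾ Ran P` (11.7).  Theorem 11.1: «the operators `H` and `F_P(H)` are isospectral at `0`»: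
(a) `0 ∈ σ(H) ⟺ 0 ∈ σ(F_P(H))`; (b) `Hψ = 0 ⟺ F_P(H)φ = 0` with `φ = Pψ`, `ψ = Qφ`, `Q := P − R_{P̄}HP` (11.8); moreover
`H` self-adjoint ⟹ `F_P(H)` self-adjoint (11.9).

What is here.  The printed proof is pure algebra in the ring of bounded operators once `R_{P̄}` is in hand ((11.30) `HQ = PF_P(H)`,
(11.31) `Q♯H = F_P(H)P` with `Q♯ := P − PHR_{P̄}` (11.28), (11.35) `1 = QP + R_{P̄}H`, Prop. 11.3 and (11.36) `F_P(H)⁻¹ = PH⁻¹P`),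
so we prove it in an ARBITRARY RING `A` (think `A = E →L[𝕜] E`, the bounded operators, or `Module.End`), for elements `H P R : A`
with `P² = P`, `R = (1−P)R = R(1−P)` and the two inverse relations `(1−P)·H·R = 1−P`, `R·H·(1−P) = 1−P` («`R` inverts `P̄HP̄` on
`Ran P̄`»), writing `fsMap H P R := PHP − PHRHP` (the Feshbach–Schur map as an element of `A`, `= 0` on `Ran P̄`),
`fsQ H P R := P − RHP`, `fsQsharp H P R := P − PHR`:

* `mul_fsQ` (11.30/11.32) `H · Q = F`;  `fsQsharp_mul` (11.31) `Q♯ · H = F`;  `fsQ_mul_add` (11.35) `Q·P + R·H = 1`;  `P_mul_fsQ` `P·Q = P`;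
* ★ `isUnit_iff_exists_corner_inverse` — **Theorem 11.1 (a), bounded/algebraic form**: `H` is invertible in `A` iff `F` is invertible
  IN THE CORNER `PAP`, i.e. `∃ G, F·G = P ∧ G·F = P`; with the explicit inverses `H⁻¹ = R − RHPGQ♯ + GQ♯` (Prop. 11.3) and
  `G = PH⁻¹P` (11.36);
* ★ `smul_eq_zero_iff_fsMap` — **Theorem 11.1 (b)** for `A` acting on any module `E` (e.g. `E →L[𝕜] E` on `E`): `H•ψ = 0 → F•(P•ψ) = 0`,
  `P•φ = φ → F•φ = 0 → H•(Q•φ) = 0`, and the two maps `ψ ↦ P•ψ`, `φ ↦ Q•φ` are mutually inverse between `Null H` and `Null F ∩ Ran P`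
  (`fsQ_smul_P_smul`, `P_smul_fsQ_smul`);
* `star_fsMap` (11.9): in a star ring, `H, P, R` self-adjoint ⟹ `F` self-adjoint (and `star Q = Q♯`).

The analytic content of the printed theorem — producing `R_{P̄}` (invertibility of `P̄HP̄` on `Ran P̄`, e.g. by a gap or a Neumann
series) and, for unbounded `H`, the domain conditions (11.6) — is the user's input `R` with its four relations; for bounded `H` on a
Hilbert space nothing else is needed.  No named facts; three abbreviations (`fsMap`, `fsQ`, `fsQsharp`) with `rfl` lemmas.

§2 (`section CornerInverse`) PRODUCES `R` in the two standard ways: `exists_corner_inverse_of_isUnit_add` (ring: `P + T` a unit,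
`T = P̄TP̄` ⟹ `R := (P+T)⁻¹ − P` inverts `T` in the corner `P̄AP̄`), `exists_corner_inverse_of_norm_lt_one` (normed ring with summable
geometric series, e.g. complete: `‖P̄ − T‖ < 1` suffices, Neumann series `Units.oneSub`), whence `exists_fsData_of_norm_lt_one`
(`‖P̄ − P̄HP̄‖ < 1` ⟹ the four relations for `H`) and, for a normed algebra over a normed field, ★ `exists_fsData_sub_of_norm_lt` /
`isUnit_algebraMap_sub_iff_of_norm_lt`: if `‖P̄KP̄‖ < ‖z‖` (the «stiff sector» of `K` lies below `|z|`) then `R_{P̄}` for `H = z·1 − K`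
exists and `z·1 − K` is invertible ⟺ `F_P(z·1 − K)` is invertible in the corner `PAP` — the transfer-operator form of isospectrality
[folklore corollary of GustafsonSigal2003 Thm. 11.1 + Neumann series; cf. the remark after (11.12), p0130].

Use (cell `ym-beyond`, crux RED `RunningReduction` of `route-QuantumFields-LuscherReduction`, lever (b) «Feshbach–Schur on the stiff
sector at fixed (L, β)»): `A` = bounded operators on `L²` of the fine lattice, `H = K_β^L − z` (transfer operator), `P` = conditional
expectation onto the slow (zero-momentum / plaquette-averaged) variables.

## References
* S. J. Gustafson, I. M. Sigal, *Mathematical Concepts of Quantum Mechanics*, Springer 2003, §11.1 Thm. 11.1, §11.4. [GustafsonSigal2003]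
-/

namespace Literature.Analysis.OperatorTheory.FeshbachSchur

section Ring

variable {A : Type*} [Ring A]

/-- The **Feshbach–Schur map** as a ring element: `F_P(H) = PHP − PHRHP` (Gustafson–Sigal (11.7), with `R = R_{P̄}`; extended by `0`
on `Ran P̄`). [cite: GustafsonSigal2003, §11.1 (11.7)] -/
def fsMap (H P R : A) : A := P * H * P - P * H * R * H * P

/-- `Q := P − RHP` (Gustafson–Sigal (11.8)): maps `Null F_P(H)` to `Null H`. [cite: GustafsonSigal2003, §11.1 (11.8)] -/
def fsQ (H P R : A) : A := P - R * H * P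

/-- `Q♯ := P − PHR` (Gustafson–Sigal (11.28)). [cite: GustafsonSigal2003, §11.4 (11.28)] -/
def fsQsharp (H P R : A) : A := P - P * H * R

/-- Unfolding `fsMap`. [cite: GustafsonSigal2003, §11.1 (11.7)] -/
theorem fsMap_def (H P R : A) : fsMap H P R = P * H * P - P * H * R * H * P := rfl

/-- Unfolding `fsQ`. [cite: GustafsonSigal2003, §11.1 (11.8)] -/
theorem fsQ_def (H P R : A) : fsQ H P R = P - R * H * P := rfl

/-- Unfolding `fsQsharp`. [cite: GustafsonSigal2003, §11.4 (11.28)] -/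
theorem fsQsharp_def (H P R : A) : fsQsharp H P R = P - P * H * R := rfl

variable {H P R : A}

/-- `R·P = 0` when `R = R(1−P)` and `P² = P`. [cite: GustafsonSigal2003, §11.4 (proof of (11.29))] -/
theorem R_mul_P (hP : P * P = P) (hRr : R * (1 - P) = R) : R * P = 0 := by
  calc R * P = R * (1 - P) * P := by rw [hRr]
    _ = R * (P - P * P) := by rw [mul_assoc, sub_mul, one_mul]
    _ = 0 := by rw [hP, sub_self, mul_zero]

/-- `P·R = 0` when `R = (1−P)R` and `P² = P`. [cite: GustafsonSigal2003, §11.4 (proof of (11.29))] -/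
theorem P_mul_R (hP : P * P = P) (hRl : (1 - P) * R = R) : P * R = 0 := by
  calc P * R = P * ((1 - P) * R) := by rw [hRl]
    _ = (P - P * P) * R := by rw [← mul_assoc, mul_sub, mul_one]
    _ = 0 := by rw [hP, sub_self, zero_mul]

/-- `F = F·P` (the Feshbach–Schur map kills `Ran P̄`). [cite: GustafsonSigal2003, §11.1 (11.7)] -/
theorem fsMap_mul_P (hP : P * P = P) : fsMap H P R * P = fsMap H P R := by
  simp only [fsMap, sub_mul, mul_assoc, hP]

/-- `F = P·F` (the Feshbach–Schur map lands in `Ran P`). [cite: GustafsonSigal2003, §11.1 (11.7)] -/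
theorem P_mul_fsMap (hP : P * P = P) : P * fsMap H P R = fsMap H P R := by
  simp only [fsMap, mul_sub, ← mul_assoc, hP]

/-- **(11.30)/(11.32): `H·Q = F_P(H)`** (as elements of `A`; printed as `HQ = PF_P(H)`). [cite: GustafsonSigal2003, §11.4 (11.30), (11.32)] -/
theorem mul_fsQ (hinv₁ : (1 - P) * H * R = 1 - P) : H * fsQ H P R = fsMap H P R := by
  -- `H Q − F = P̄HP − P̄HRHP` and `P̄HR = P̄`
  have e : H * fsQ H P R - fsMap H P R = (1 - P) * H * P - ((1 - P) * H * R) * H * P := by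
    simp only [fsQ, fsMap]
    noncomm_ring
  rw [hinv₁, sub_self] at e
  exact sub_eq_zero.mp e

/-- **(11.31): `Q♯·H = F_P(H)`** (printed as `Q♯H = F_P(H)P`). [cite: GustafsonSigal2003, §11.4 (11.31)] -/
theorem fsQsharp_mul (hinv₂ : R * H * (1 - P) = 1 - P) : fsQsharp H P R * H = fsMap H P R := by
  have e : fsQsharp H P R * H - fsMap H P R = P * H * (1 - P) - P * H * (R * H * (1 - P)) := by
    simp only [fsQsharp, fsMap]
    noncomm_ring
  rw [hinv₂, sub_self] at e
  exact sub_eq_zero.mp e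

/-- **(11.35): `Q·P + R·H = 1`.** [cite: GustafsonSigal2003, §11.4 (11.35)] -/
theorem fsQ_mul_add (hP : P * P = P) (hinv₂ : R * H * (1 - P) = 1 - P) :
    fsQ H P R * P + R * H = 1 := by
  have e : fsQ H P R * P + R * H - 1 = (P * P - P) - R * H * (P * P - P) + (R * H * (1 - P) - (1 - P)) := by
    simp only [fsQ]
    noncomm_ring
  rw [hP, hinv₂, sub_self, sub_self, mul_zero, sub_zero, add_zero] at e
  exact sub_eq_zero.mp e

/-- `P·Q = P` (so `P(Qφ) = Pφ = φ` on `Ran P`). [cite: GustafsonSigal2003, §11.4 (11.29)] -/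
theorem P_mul_fsQ (hP : P * P = P) (hRl : (1 - P) * R = R) : P * fsQ H P R = P := by
  have hPR : P * R = 0 := P_mul_R hP hRl
  simp only [fsQ, mul_sub, ← mul_assoc, hP, hPR, zero_mul, sub_zero]

/-- **Proposition 11.3 (⇐ of Thm. 11.1 (a))**: if `F_P(H)` has an inverse `G` in the corner `PAP` (`F·G = P = G·F`), then `H` is invertible,
with `H⁻¹ = R − R·H·P·G·Q♯ + G·Q♯`. [cite: GustafsonSigal2003, §11.4 Prop. 11.3] -/
theorem isUnit_of_corner_inverse (hP : P * P = P)
    (hinv₁ : (1 - P) * H * R = 1 - P) (hinv₂ : R * H * (1 - P) = 1 - P) {G : A}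
    (hG₁ : fsMap H P R * G = P) (hG₂ : G * fsMap H P R = P) : IsUnit H := by
  have hF₁ := mul_fsQ (P := P) hinv₁            -- `H Q = F`
  have hF₂ := fsQsharp_mul (P := P) hinv₂        -- `Q♯ H = F`
  -- left inverse `L := R − R H P G Q♯ + G Q♯`
  set L : A := R - R * H * P * G * fsQsharp H P R + G * fsQsharp H P R with hL
  have hLH : L * H = 1 := by
    have e1 : L * H = R * H - R * H * P * (G * (fsQsharp H P R * H)) + G * (fsQsharp H P R * H) := by
      rw [hL]; noncomm_ring
    rw [e1, hF₂, hG₂]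
    -- `R H − R H P P + P = R H (1 − P) + P = 1`
    have e2 : R * H - R * H * P * P + P - 1 = R * H * (1 - P) - (1 - P) - R * H * (P * P - P) := by noncomm_ring
    rw [hP, hinv₂, sub_self, sub_self, mul_zero, sub_zero] at e2
    exact sub_eq_zero.mp e2
  -- right inverse `L' := R − Q G P H R + Q G`
  set L' : A := R - fsQ H P R * G * P * H * R + fsQ H P R * G with hL'
  have hHL' : H * L' = 1 := by
    have e1 : H * L' = H * R - (H * fsQ H P R) * G * P * H * R + (H * fsQ H P R) * G := by
      rw [hL']; noncomm_ring
    rw [e1, hF₁, hG₁]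
    have e2 : H * R - P * P * H * R + P - 1 = (1 - P) * H * R - (1 - P) - (P * P - P) * H * R := by noncomm_ring
    rw [hP, hinv₁, sub_self, sub_self, zero_mul, zero_mul, sub_zero] at e2
    rw [hP]
    exact sub_eq_zero.mp e2
  have hLL' : L = L' := by
    calc L = L * (H * L') := by rw [hHL', mul_one]
      _ = (L * H) * L' := by rw [mul_assoc]
      _ = L' := by rw [hLH, one_mul]
  rw [hLL'] at hLH
  exact ⟨⟨H, L', hHL', hLH⟩, rfl⟩

/-- **(11.36) (⇒ of Thm. 11.1 (a))**: if `H` is invertible then `G := P·H⁻¹·P` inverts `F_P(H)` in the corner `PAP`.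
[cite: GustafsonSigal2003, §11.4 (11.36)] -/
theorem corner_inverse_of_isUnit (hP : P * P = P) (hRl : (1 - P) * R = R) (hRr : R * (1 - P) = R)
    (hinv₁ : (1 - P) * H * R = 1 - P) (hinv₂ : R * H * (1 - P) = 1 - P) {M : A} (hMH : M * H = 1) (hHM : H * M = 1) :
    fsMap H P R * (P * M * P) = P ∧ (P * M * P) * fsMap H P R = P := by
  have hRP : R * P = 0 := R_mul_P hP hRr
  have hPR : P * R = 0 := P_mul_R hP hRl
  constructor
  · have e : fsMap H P R * (P * M * P) - P =
        P * H * (P * P - P) * M * P - P * H * R * H * (P * P - P) * M * P + P * (H * M - 1) * P + (P * P - P)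
          - P * H * R * (H * M - 1) * P - P * H * (R * P) + P * H * (R * H * (1 - P) - (1 - P)) * M * P := by
      simp only [fsMap]; noncomm_ring
    rw [hP, hHM, hRP, hinv₂] at e
    simp only [sub_self, mul_zero, zero_mul, add_zero] at e
    exact sub_eq_zero.mp e
  · have e : P * M * P * fsMap H P R - P =
        P * M * (P * P - P) * H * P - P * M * (P * P - P) * H * R * H * P + P * (M * H - 1) * P + (P * P - P)
          - P * (M * H - 1) * R * H * P - (P * R) * H * P + P * M * ((1 - P) * H * R - (1 - P)) * H * P := by
      simp only [fsMap]; noncomm_ring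
    rw [hP, hMH, hPR, hinv₁] at e
    simp only [sub_self, mul_zero, zero_mul, add_zero] at e
    exact sub_eq_zero.mp e

/-- ★ **Theorem 11.1 (a), algebraic form: `H` is invertible ⟺ `F_P(H)` is invertible in the corner `PAP`** (for `A` = the bounded operators
this is `0 ∈ ρ(H) ⟺ 0 ∈ ρ(F_P(H) ↾ Ran P)`, i.e. isospectrality at `0`). [cite: GustafsonSigal2003, §11.1 Thm. 11.1 (a)] -/
theorem isUnit_iff_exists_corner_inverse (hP : P * P = P) (hRl : (1 - P) * R = R) (hRr : R * (1 - P) = R)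
    (hinv₁ : (1 - P) * H * R = 1 - P) (hinv₂ : R * H * (1 - P) = 1 - P) :
    IsUnit H ↔ ∃ G : A, fsMap H P R * G = P ∧ G * fsMap H P R = P := by
  constructor
  · intro hH
    obtain ⟨u, rfl⟩ := hH
    exact ⟨P * ↑u⁻¹ * P, corner_inverse_of_isUnit hP hRl hRr hinv₁ hinv₂ (u.inv_mul) (u.mul_inv)⟩
  · rintro ⟨G, hG₁, hG₂⟩
    exact isUnit_of_corner_inverse hP hinv₁ hinv₂ hG₁ hG₂

end Ring

/-! ## Theorem 11.1 (b): the kernel correspondence, for `A` acting on a module -/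

section Kernel

variable {A : Type*} [Ring A] {E : Type*} [AddCommGroup E] [Module A E] {H P R : A}

/-- `Hψ = 0 ⟹ F_P(H)(Pψ) = 0` (indeed `F(Pψ) = Fψ = Q♯(Hψ)`). [cite: GustafsonSigal2003, §11.1 Thm. 11.1 (b)] -/
theorem fsMap_smul_P_smul_eq_zero (hP : P * P = P) (hinv₂ : R * H * (1 - P) = 1 - P)
    {ψ : E} (hψ : H • ψ = 0) : fsMap H P R • P • ψ = 0 := by
  rw [← mul_smul, fsMap_mul_P hP, ← fsQsharp_mul hinv₂, mul_smul, hψ, smul_zero]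

/-- `F_P(H)φ = 0 ⟹ H(Qφ) = 0` (indeed `H(Qφ) = Fφ`). [cite: GustafsonSigal2003, §11.1 Thm. 11.1 (b)] -/
theorem H_smul_fsQ_smul_eq_zero (hinv₁ : (1 - P) * H * R = 1 - P)
    {φ : E} (hφ : fsMap H P R • φ = 0) : H • fsQ H P R • φ = 0 := by
  rw [← mul_smul, mul_fsQ hinv₁, hφ]

/-- `Q(Pψ) = ψ` on `Null H` ((11.35) applied to `ψ`). [cite: GustafsonSigal2003, §11.4 (11.35)] -/
theorem fsQ_smul_P_smul (hP : P * P = P) (hinv₂ : R * H * (1 - P) = 1 - P)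
    {ψ : E} (hψ : H • ψ = 0) : fsQ H P R • P • ψ = ψ := by
  have h := fsQ_mul_add (H := H) (R := R) hP hinv₂
  calc fsQ H P R • P • ψ = (fsQ H P R * P + R * H) • ψ := by rw [add_smul, mul_smul, mul_smul, hψ, smul_zero, add_zero]
    _ = ψ := by rw [h, one_smul]

/-- `P(Qφ) = φ` on `Ran P` (`P·Q = P`). [cite: GustafsonSigal2003, §11.4 (11.29)] -/
theorem P_smul_fsQ_smul (hP : P * P = P) (hRl : (1 - P) * R = R) {φ : E} (hφ : P • φ = φ) :
    P • fsQ H P R • φ = φ := by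
  rw [← mul_smul, P_mul_fsQ hP hRl, hφ]

/-- ★ **Theorem 11.1 (b): `Null H` and `Null F_P(H) ∩ Ran P` correspond under `ψ ↦ Pψ`, `φ ↦ Qφ`.** For `ψ` with `Hψ = 0`: `F(Pψ) = 0`,
`P(Pψ) = Pψ` and `Q(Pψ) = ψ`; for `φ = Pφ` with `Fφ = 0`: `H(Qφ) = 0` and `P(Qφ) = φ`.  (In particular `Null P ∩ Null H = 0` and
`Null Q ∩ Null F ∩ Ran P = 0`, (11.29).) [cite: GustafsonSigal2003, §11.1 Thm. 11.1 (b)] -/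
theorem smul_eq_zero_iff_fsMap (hP : P * P = P) (hRl : (1 - P) * R = R)
    (hinv₁ : (1 - P) * H * R = 1 - P) (hinv₂ : R * H * (1 - P) = 1 - P) :
    (∀ ψ : E, H • ψ = 0 → fsMap H P R • P • ψ = 0 ∧ P • P • ψ = P • ψ ∧ fsQ H P R • P • ψ = ψ) ∧
    (∀ φ : E, P • φ = φ → fsMap H P R • φ = 0 → H • fsQ H P R • φ = 0 ∧ P • fsQ H P R • φ = φ) := by
  refine ⟨fun ψ hψ => ⟨fsMap_smul_P_smul_eq_zero hP hinv₂ hψ, ?_, fsQ_smul_P_smul hP hinv₂ hψ⟩,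
    fun φ hφ hF => ⟨H_smul_fsQ_smul_eq_zero hinv₁ hF, P_smul_fsQ_smul hP hRl hφ⟩⟩
  rw [← mul_smul, hP]

end Kernel

/-! ## (11.9): self-adjointness is transmitted -/

section Star

variable {A : Type*} [Ring A] [StarRing A] {H P R : A}

/-- **(11.9)**: if `H`, `P`, `R` are self-adjoint then so is `F_P(H)`. [cite: GustafsonSigal2003, §11.1 (11.9)] -/
theorem star_fsMap (hH : star H = H) (hPs : star P = P) (hRs : star R = R) : star (fsMap H P R) = fsMap H P R := by
  simp only [fsMap, star_sub, star_mul, hH, hPs, hRs, mul_assoc]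

/-- `star Q = Q♯` for self-adjoint data. [cite: GustafsonSigal2003, §11.4 (11.28)] -/
theorem star_fsQ (hH : star H = H) (hPs : star P = P) (hRs : star R = R) : star (fsQ H P R) = fsQsharp H P R := by
  simp only [fsQ, fsQsharp, star_sub, star_mul, hH, hPs, hRs, mul_assoc]

end Star

/-! ## §2 Producing `R_{P̄}`: corner inverses from a unit, from a Neumann series, and for `z·1 − K` with `‖P̄KP̄‖ < ‖z‖` -/

section CornerInverse

variable {A : Type*} [Ring A] {P T : A}

/-- Ring form: if `P² = P`, `T = P̄TP̄` (`P̄ = 1 − P`) and the block-diagonal element `P + T` is a unit of `A`, then `R := (P + T)⁻¹ − P`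
satisfies `R = P̄R = RP̄` and `TR = P̄ = RT`, i.e. `R` inverts `T` in the corner `P̄AP̄` (the book's standing hypothesis «`H_{P̄}` invertible»
(11.6), made algebraic). [cite: GustafsonSigal2003, §11.1 (11.6)] -/
theorem exists_corner_inverse_of_isUnit_add (hP : P * P = P) (hTl : (1 - P) * T = T) (hTr : T * (1 - P) = T)
    (hu : IsUnit (P + T)) :
    ∃ R : A, (1 - P) * R = R ∧ R * (1 - P) = R ∧ T * R = 1 - P ∧ R * T = 1 - P := by
  obtain ⟨u, hu⟩ := hu
  set M : A := ↑u⁻¹ with hM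
  have hMu : M * (P + T) = 1 := by rw [hM, ← hu, Units.inv_mul]
  have huM : (P + T) * M = 1 := by rw [hM, ← hu, Units.mul_inv]
  have hTP : T * P = 0 := by
    calc T * P = T * (1 - P) * P := by rw [hTr]
      _ = T * (P - P * P) := by rw [mul_assoc, sub_mul, one_mul]
      _ = 0 := by rw [hP, sub_self, mul_zero]
  have hPT : P * T = 0 := by
    calc P * T = P * ((1 - P) * T) := by rw [hTl]
      _ = (P - P * P) * T := by rw [← mul_assoc, mul_sub, mul_one]
      _ = 0 := by rw [hP, sub_self, zero_mul]
  have hMP : M * P = P := by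
    have e : M * (P + T) * P = P := by rw [hMu, one_mul]
    rwa [mul_assoc, add_mul, hP, hTP, add_zero] at e
  have hPM : P * M = P := by
    have e : P * ((P + T) * M) = P := by rw [huM, mul_one]
    rwa [← mul_assoc, mul_add, hP, hPT, add_zero] at e
  refine ⟨M - P, ?_, ?_, ?_, ?_⟩
  · rw [mul_sub, sub_mul, one_mul, sub_mul, one_mul, hPM, hP, sub_self, sub_zero]
  · rw [mul_sub, mul_one, sub_mul, hMP, hP, sub_self, sub_zero]
  · rw [mul_sub, hTP, sub_zero]
    have e : (P + T) * M - P * M = T * M := by rw [add_mul, add_sub_cancel_left]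
    rw [← e, huM, hPM]
  · rw [sub_mul, hPT, sub_zero]
    have e : M * (P + T) - M * P = M * T := by rw [mul_add, add_sub_cancel_left]
    rw [← e, hMu, hMP]

variable {B : Type*} [NormedRing B] [HasSummableGeomSeries B] {P T H : B}

/-- Neumann-series form (normed ring with summable geometric series, e.g. a complete normed ring = the bounded operators): if
`T = P̄TP̄` and `‖P̄ − T‖ < 1` then `T` is invertible in the corner `P̄BP̄` (Neumann series, `Units.oneSub`; the book's «as can be readily
verified» after (11.12)). [cite: GustafsonSigal2003, §11.1 (11.6), (11.12)] -/
theorem exists_corner_inverse_of_norm_lt_one (hP : P * P = P) (hTl : (1 - P) * T = T) (hTr : T * (1 - P) = T)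
    (h : ‖(1 - P) - T‖ < 1) :
    ∃ R : B, (1 - P) * R = R ∧ R * (1 - P) = R ∧ T * R = 1 - P ∧ R * T = 1 - P := by
  have hu : IsUnit (P + T) := by
    have e : P + T = 1 - ((1 - P) - T) := by abel
    rw [e]
    exact isUnit_one_sub_of_norm_lt_one h
  exact exists_corner_inverse_of_isUnit_add hP hTl hTr hu

/-- The four Feshbach–Schur relations for `H` from `‖P̄ − P̄HP̄‖ < 1`: there is `R = R_{P̄}` with `P̄R = R = RP̄`, `P̄HR = P̄`, `RHP̄ = P̄` —
exactly the hypotheses of `isUnit_iff_exists_corner_inverse` / `smul_eq_zero_iff_fsMap` (condition (11.6) verified by a Neumann series).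
[cite: GustafsonSigal2003, §11.1 (11.6), (11.12)] -/
theorem exists_fsData_of_norm_lt_one (hP : P * P = P) (h : ‖(1 - P) - (1 - P) * H * (1 - P)‖ < 1) :
    ∃ R : B, (1 - P) * R = R ∧ R * (1 - P) = R ∧ (1 - P) * H * R = 1 - P ∧ R * H * (1 - P) = 1 - P := by
  have hPbar : (1 - P) * (1 - P) = 1 - P := by
    rw [mul_sub, sub_mul, one_mul, mul_one, sub_mul, one_mul, hP, sub_self, sub_zero]
  have hTl : (1 - P) * ((1 - P) * H * (1 - P)) = (1 - P) * H * (1 - P) := by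
    rw [← mul_assoc, ← mul_assoc, hPbar]
  have hTr : (1 - P) * H * (1 - P) * (1 - P) = (1 - P) * H * (1 - P) := by
    rw [mul_assoc, hPbar]
  obtain ⟨R, hRl, hRr, hTR, hRT⟩ := exists_corner_inverse_of_norm_lt_one hP hTl hTr h
  refine ⟨R, hRl, hRr, ?_, ?_⟩
  · rwa [mul_assoc ((1 - P) * H) (1 - P) R, hRl] at hTR
  · rwa [← mul_assoc, ← mul_assoc, hRr] at hRT

variable {𝕜 : Type*} [NormedField 𝕜] [NormedAlgebra 𝕜 B] {K : B} {z : 𝕜}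

/-- ★ Transfer-operator form of the data: if the «stiff block» of `K` is small, `‖P̄KP̄‖ < ‖z‖`, then `R_{P̄}` exists for `H = z·1 − K`
(`P̄(z·1 − K)P̄ = z(P̄ − z⁻¹P̄KP̄)` is inverted on `Ran P̄` by a Neumann series: condition (11.12) ⟹ (11.6) of the book for `H_κ − λ`
with `κW ↦ −K`, `λ₀ ↦ 0`, `λ ↦ −z`). [cite: GustafsonSigal2003, §11.1 (11.6), (11.12)] -/
theorem exists_fsData_sub_of_norm_lt (hP : P * P = P) (hz : ‖(1 - P) * K * (1 - P)‖ < ‖z‖) :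
    ∃ R : B, (1 - P) * R = R ∧ R * (1 - P) = R ∧
      (1 - P) * (algebraMap 𝕜 B z - K) * R = 1 - P ∧ R * (algebraMap 𝕜 B z - K) * (1 - P) = 1 - P := by
  have hz0 : z ≠ 0 := by
    rintro rfl
    have h0 : (0 : ℝ) < ‖(0 : 𝕜)‖ := (norm_nonneg _).trans_lt hz
    simp at h0
  have hPbar : (1 - P) * (1 - P) = 1 - P := by
    rw [mul_sub, sub_mul, one_mul, mul_one, sub_mul, one_mul, hP, sub_self, sub_zero]
  set Q : B := 1 - P with hQ
  -- `T := Q − z⁻¹ QKQ = z⁻¹ · Q (z1 − K) Q`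
  set T : B := Q - z⁻¹ • (Q * K * Q) with hT
  have hTl : Q * T = T := by
    rw [hT, mul_sub, hPbar, mul_smul_comm, ← mul_assoc, ← mul_assoc, hPbar]
  have hTr : T * Q = T := by
    rw [hT, sub_mul, hPbar, smul_mul_assoc, mul_assoc (Q * K) Q Q, hPbar]
  have hnorm : ‖Q - T‖ < 1 := by
    rw [hT, sub_sub_cancel, norm_smul, norm_inv]
    rwa [inv_mul_lt_iff₀ (norm_pos_iff.mpr hz0), mul_one]
  obtain ⟨R', hRl', hRr', hTR', hRT'⟩ := exists_corner_inverse_of_norm_lt_one hP hTl hTr hnorm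
  -- `Q (z1 − K) Q = z • T`
  have hblock : Q * (algebraMap 𝕜 B z - K) * Q = z • T := by
    rw [hT, smul_sub, smul_smul, mul_inv_cancel₀ hz0, one_smul, Algebra.algebraMap_eq_smul_one, mul_sub Q (z • (1 : B)) K,
      sub_mul (Q * (z • (1 : B))) (Q * K) Q, mul_smul_comm, mul_one, smul_mul_assoc, hPbar]
  refine ⟨z⁻¹ • R', ?_, ?_, ?_, ?_⟩
  · rw [mul_smul_comm, hRl']
  · rw [smul_mul_assoc, hRr']
  · rw [← hRl', mul_smul_comm, ← mul_assoc, hblock, smul_mul_assoc, smul_smul, inv_mul_cancel₀ hz0, one_smul, hTR']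
  · rw [← hRr', smul_mul_assoc, smul_mul_assoc, mul_assoc R' Q _, mul_assoc R' (Q * _) Q, hblock, mul_smul_comm, smul_smul,
      inv_mul_cancel₀ hz0, one_smul, hRT']

/-- ★ **Isospectrality for a transfer operator with a small stiff block**: if `‖P̄KP̄‖ < ‖z‖` then `z·1 − K` is invertible in `B`
iff the Feshbach–Schur map `F_P(z·1 − K)` (built with the `R_{P̄}` of `exists_fsData_sub_of_norm_lt`) is invertible in the corner `PBP`.
[cite: GustafsonSigal2003, §11.1 Thm. 11.1 (a), with (11.12) ⟹ (11.6)] -/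
theorem isUnit_algebraMap_sub_iff_of_norm_lt (hP : P * P = P) (hz : ‖(1 - P) * K * (1 - P)‖ < ‖z‖) :
    ∃ R : B, (1 - P) * R = R ∧ R * (1 - P) = R ∧
      (IsUnit (algebraMap 𝕜 B z - K) ↔
        ∃ G : B, fsMap (algebraMap 𝕜 B z - K) P R * G = P ∧ G * fsMap (algebraMap 𝕜 B z - K) P R = P) := by
  obtain ⟨R, hRl, hRr, h₁, h₂⟩ := exists_fsData_sub_of_norm_lt hP hz
  exact ⟨R, hRl, hRr, isUnit_iff_exists_corner_inverse hP hRl hRr h₁ h₂⟩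

end CornerInverse

end Literature.Analysis.OperatorTheory.FeshbachSchur
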